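/-
Origin: expansion seat `prover-pub-hodgecm-mc-binder-2-g6-0`, handover #1 13:47Z md5 55e596e2a0dc (398 l.; (J-arch) §1 stripping `toSp_arch_apply_eq_self`, §2 `archProdHom`, `hfin_pairSplitting_arch`, `archWeilRep`, `omega_pairSplitting_arch_map_tmul`, `continuous_archWeilRep`; FROZEN shape — D-3 rows depend on it) (`HOME/mc/pub-hodgecm-mc-binder-2/g6/pkg/HodgeCM/Model/HypCensus/ArchFactor.lean`, md5 55e596e2, 398 lines);
landed by the gen-12 packager (p-g12) in gate run 36 as `HodgeCM/Model/HypCensus/ArchFactor.lean` (verbatim).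
-/
/-
Origin: speedrun cell pub-hodgecm, MODEL-CONSTRUCTION sub-cell, lineage mc-binder-2 (rows A12/A34: `hyp12` / `hyp34`;
junction (J-arch) of BINDER-TRIAGE §50.2), seat prover-pub-hodgecm-mc-binder-2-g6-0 (gen 6), 2026-08-19.
Target in PKG: `HodgeCM/Model/HypCensus/ArchFactor.lean` (NEW additive leaf; RUN 36+, after K-1: every import is a K-1 v19
twin).  KERNEL only: 0 records / named facts, 0 proof holes.
-/
import Literature.NumberTheory.Weil1964.AdelicMetaplecticTensorStripping
import Literature.NumberTheory.GelbartRogawski1991.UnitaryDualPairSplittingDatum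
import Literature.NumberTheory.Automorphic.UnitaryGroupArchimedean
import Literature.NumberTheory.Weil1964.AdelicMetaplecticArchRep
import Literature.NumberTheory.Automorphic.SiegelVolumeDecay
import Literature.NumberTheory.Automorphic.SatakeParameterTrivialBound

/-!
# Census kit (rows A12/A34), junction (J-arch) §1: ARCHIMEDEAN elements of the dual pair act by `A ⊗ 1`

For the unitary dual pair `U(J_V) × U(J_W)` of [GelbartRogawski1991, §3.1] over a quadratic extension `E/F` of
number fields (`J_V = T_V ⊗ 1`, `J_W = T_W ⊗ 1`, `T_V`, `T_W` symmetric invertible over `F`), ANY homomorphism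
`s : G₁(𝔸_F) → Mp_ψ(𝕎_𝔸)ᶜᵒⁿᵗ` lying over `toSp` (e.g. a compatible splitting, `proj_pairSplitting`; at the CM pin
`cmPairSplitting … hGR`, `proj_cmPairSplitting`) and any ARCHIMEDEAN pair element `g = (x ⊗ 1)(1 ⊗ y)`,
`x = (x_∞, 1) ∈ U(J_V)(𝔸_F)`, `y = (y_∞, 1) ∈ U(J_W)(𝔸_F)` (`archToAdelic`):

* `toSp_arch_apply_eq_self` — the symplectic transformation `toSp g` of `𝕎_𝔸 = 𝔸_F^n × 𝔸_F^n` FIXES every vector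
  with vanishing archimedean components (its `𝔸_E`-matrix `x ⊗ y` has finite component `1`:
  `pair_archToAdelic_apply_snd`, `GLn_ofInfinite_apply_snd`; restriction of scalars `resAut_reIm`;
  `mulVec_eq_self_of_snd_eq_one`);
* hence `1 ⊗ 1` implements `toSp g` on Weil's finite Heisenberg elements and the tree's TENSOR STRIPPING theorem
  (`Weil1964.exists_continuousLinearEquiv_map_tmul_of_mem_adelicMpCont`, [Weil1964, Chap. III n° 37–38]) applies
  with `M_f = 1`: **`exists_archFactor`** — there is a topological automorphism `A` of the archimedean Schwartz space
  `𝓢((F ⊗ ℝ)^n)` with `ω_ψ(s g) (Φ_∞ ⊗ Φ_f) = (A Φ_∞) ⊗ Φ_f` for all `Φ_∞`, `Φ_f` (`exists_archFactor_of_fix` is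
  the same over any `g` whose `toSp g` fixes the finitely supported vectors).

This is the first half of junction (J-arch) («adelic → archimedean Weil datum at the pin»): the archimedean
FACTOR of the pinned Weil representation at archimedean group elements EXISTS as an operator on `𝓢_∞` and is cut
out exactly (no scalar ambiguity) by `M_f = 1`.  §2 (its homomorphy in `g`, Heisenberg covariance over weil-2's
dictionary `archPhaseMap_toSp_pair`, continuity, unitarity ⇒ `IsArchWeilDatum`) is the successor file `ArchDatum.lean`.

Inputs (tree, vendored): `Weil1964/AdelicMetaplecticTensorStripping` (`finHeisenberg`, `finIdem_mul`,
`exists_continuousLinearEquiv_map_tmul_of_mem_adelicMpCont`), `GelbartRogawski1991/UnitaryDualPairSplittingDatum`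
(`toSp`, `toSp_apply`, `adelicGram`, `isUnit_det_adelicGram`), `Automorphic/UnitaryGroupDualPairCarriers`
(`adelicInl/Inr`, `coe_adelicInl/Inr`, `adelicPairToSymplectic`), `Automorphic/UnitaryGroupSymplecticEmbedding`
(`resAut_reIm`, `reIm`), `Automorphic/QuadraticAdeleBaseChange` / `QuadraticRestrictionOfScalars`
(`quadraticAdeleEquiv`, `isQuadraticCoordinates_adele`), `Automorphic/AdelicGLnGlue` (`GLn.coe_ofInfinite_apply`),
`Automorphic/UnitaryGroupArchimedean` (`archToAdelic`), `Automorphic/AdelicSchwartzBruhatTensor` (`adelicTensorEnd_id`).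
Nothing here is a claim of PerL/QW8.  `exists_archFactor_of_fix` needs `maxHeartbeats 4000000` (one slow unification
of the stripping theorem's `hMf` hypothesis; 35 s wall in the private build).
-/

set_option autoImplicit false

noncomputable section

open NumberField IsDedekindDomain
open scoped Matrix
open scoped Kronecker Classical
open Literature.NumberTheory.Automorphic Literature.NumberTheory.Weil1964
open Literature.RepresentationTheory.HeisenbergGroup (polar Heisenberg symplecticGroup ofSymplectic ofSymplectic_σ ofSymplectic_f)
open scoped TensorProduct
open Literature.NumberTheory.GelbartRogawski1991

namespace HodgeCM.Model.HypCensus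

section FinPart

variable {K : Type} [Field K] [NumberField K] {ι' : Type} [Fintype ι'] [DecidableEq ι']

/-- components of a product of adeles (the adele ring is a `def`, so `Prod.fst_mul` does not fire). -/
alias adele_mul_fst := Literature.NumberTheory.Automorphic.fst_mul_adele
/-- components of a product of adeles. -/
alias adele_mul_snd := Literature.NumberTheory.Automorphic.AdeleRing.mul_snd

/-- A matrix over `𝔸_K` whose FINITE components are those of the identity matrix fixes every vector with vanishing
archimedean components. -/
theorem mulVec_eq_self_of_snd_eq_one (m : Matrix ι' ι' (AdeleRing (𝓞 K) K))
    (hm : ∀ i j, (m i j).2 = (1 : Matrix ι' ι' (FiniteAdeleRing (𝓞 K) K)) i j)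
    (x : ι' → AdeleRing (𝓞 K) K) (hx : ∀ i, (x i).1 = 0) : m *ᵥ x = x := by
  funext i
  refine Prod.ext ?_ ?_
  · rw [Matrix.mulVec, dotProduct, Literature.NumberTheory.Automorphic.AdeleRing.fst_sum, hx i]
    refine Finset.sum_eq_zero fun j _ => ?_
    rw [adele_mul_fst, hx j, mul_zero]
  · rw [Matrix.mulVec, dotProduct, Literature.NumberTheory.Automorphic.AdeleRing.snd_sum]
    simp_rw [adele_mul_snd, hm, Matrix.one_apply, ite_mul, one_mul, zero_mul, Finset.sum_ite_eq,
      Finset.mem_univ, if_true]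

/-- The archimedean embedding `GLₙ(K ⊗ ℝ) → GLₙ(𝔸_K)`, `g ↦ (g, 1)`: finite components of the entries. -/
theorem GLn_ofInfinite_apply_snd {n : ℕ} (g : GL (Fin n) (mixedEmbedding.mixedSpace K)) (i j : Fin n) :
    (((GLn.ofInfinite n K g : GL (Fin n) (AdeleRing (𝓞 K) K)) : Matrix (Fin n) (Fin n) (AdeleRing (𝓞 K) K)) i j).2 =
      (1 : Matrix (Fin n) (Fin n) (FiniteAdeleRing (𝓞 K) K)) i j := by
  rw [GLn.coe_ofInfinite_apply]

end FinPart

section Pair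

variable (F E : Type) [Field F] [NumberField F] [Field E] [NumberField E] [Algebra F E]
variable (c : E ≃ₐ[F] E) (N M : ℕ) (JV : Matrix (Fin N) (Fin N) E) (JW : Matrix (Fin M) (Fin M) E)

/-- finite components of a Kronecker product of adelic matrices. -/
theorem kronecker_apply_snd {n m : Type} (A : Matrix n n (AdeleRing (𝓞 E) E)) (B : Matrix m m (AdeleRing (𝓞 E) E))
    (p q : n × m) : ((A ⊗ₖ B) p q).2 = (A p.1 q.1).2 * (B p.2 q.2).2 := rfl

/-- The `GL_{NM}(𝔸_E)`-matrix of an ARCHIMEDEAN pair element `(x ⊗ 1)(1 ⊗ y)`, `x = (x_∞, 1)`, `y = (y_∞, 1)`, has the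
identity as finite component. -/
theorem pair_archToAdelic_apply_snd (x : UnitaryGroup.arch F E c N JV) (y : UnitaryGroup.arch F E c M JW)
    (p q : Fin N × Fin M) :
    ((((UnitaryGroup.adelicInl F E c N M JV JW (UnitaryGroup.archToAdelic F E c N JV x) *
          UnitaryGroup.adelicInr F E c N M JV JW (UnitaryGroup.archToAdelic F E c M JW y) :
            UnitaryGroup.adelicPair F E c N M JV JW) : GL (Fin N × Fin M) (AdeleRing (𝓞 E) E)) :
          Matrix (Fin N × Fin M) (Fin N × Fin M) (AdeleRing (𝓞 E) E)) p q).2 =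
      (1 : Matrix (Fin N × Fin M) (Fin N × Fin M) (FiniteAdeleRing (𝓞 E) E)) p q := by
  have hx : Subtype.val (UnitaryGroup.archToAdelic F E c N JV x) =
      GLn.ofInfinite N E (Subtype.val x) := rfl
  have hy : Subtype.val (UnitaryGroup.archToAdelic F E c M JW y) =
      GLn.ofInfinite M E (Subtype.val y) := rfl
  rw [Subgroup.coe_mul, Units.val_mul, UnitaryGroup.coe_adelicInl, UnitaryGroup.coe_adelicInr,
    ← Matrix.mul_kronecker_mul, Matrix.mul_one, Matrix.one_mul, kronecker_apply_snd, hx, hy,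
    GLn_ofInfinite_apply_snd, GLn_ofInfinite_apply_snd, Matrix.one_apply, Matrix.one_apply, Matrix.one_apply]
  obtain ⟨p1, p2⟩ := p
  obtain ⟨q1, q2⟩ := q
  by_cases h1 : (p1 = q1)
  · by_cases h2 : (p2 = q2)
    · simp [h1, h2]
    · simp [h1, h2]
  · simp [h1]

/-- **An ARCHIMEDEAN pair element fixes every finitely supported vector of `𝕎_𝔸`** (its symplectic action is the
restriction of scalars of an `𝔸_E`-matrix with finite component `1`). -/
theorem toSp_arch_apply_eq_self [Algebra.IsQuadraticExtension F E] {δ : E} (hcδ : c δ = -δ) (hδ : δ ≠ 0)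
    {d : F} (hd : δ * δ = algebraMap F E d) {TV : Matrix (Fin N) (Fin N) F} {TW : Matrix (Fin M) (Fin M) F}
    (hV : TV.IsSymm) (hW : TW.IsSymm) (hJV : JV = TV.map (algebraMap F E)) (hJW : JW = TW.map (algebraMap F E))
    {n : ℕ} (e : Fin N × Fin M ≃ Fin n) (x : UnitaryGroup.arch F E c N JV) (y : UnitaryGroup.arch F E c M JW)
    (v : (Fin n → AdeleRing (𝓞 F) F) × (Fin n → AdeleRing (𝓞 F) F))
    (hv1 : ∀ i, (v.1 i).1 = 0) (hv2 : ∀ i, (v.2 i).1 = 0) :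
    ((UnitaryDualPair.toSp F E c N M e JV JW hcδ hδ hd hV hW hJV hJW
        (UnitaryGroup.adelicInl F E c N M JV JW (UnitaryGroup.archToAdelic F E c N JV x) *
          UnitaryGroup.adelicInr F E c N M JV JW (UnitaryGroup.archToAdelic F E c M JW y)) :
        symplecticGroup (polar (adelicForm F (Fin n) (UnitaryDualPair.adelicGram F e TV TW)))) :
      ((Fin n → AdeleRing (𝓞 F) F) × (Fin n → AdeleRing (𝓞 F) F)) ≃ₗ[AdeleRing (𝓞 F) F]
        ((Fin n → AdeleRing (𝓞 F) F) × (Fin n → AdeleRing (𝓞 F) F))) v = v := by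
  set g := UnitaryGroup.adelicInl F E c N M JV JW (UnitaryGroup.archToAdelic F E c N JV x) *
    UnitaryGroup.adelicInr F E c N M JV JW (UnitaryGroup.archToAdelic F E c M JW y) with hg
  set h := UnitaryGroup.isQuadraticCoordinates_adele E c hcδ hδ hd with hh
  rw [UnitaryDualPair.toSp_apply, UnitaryGroup.coe_spReindex_apply]
  -- the un-reindexed vector and its `𝔸_E`-coordinates
  set w : (Fin N × Fin M → AdeleRing (𝓞 F) F) × (Fin N × Fin M → AdeleRing (𝓞 F) F) :=
    (UnitaryGroup.reindexW (AdeleRing (𝓞 F) F) e).symm v with hw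
  set X : Fin N × Fin M → AdeleRing (𝓞 E) E :=
    (UnitaryGroup.QuadraticCoordinates.reIm (UnitaryGroup.quadraticAdeleEquiv F E c hcδ hδ).toAddEquiv (Fin N × Fin M)).symm w with hX
  have hwX : w = UnitaryGroup.QuadraticCoordinates.reIm (UnitaryGroup.quadraticAdeleEquiv F E c hcδ hδ).toAddEquiv (Fin N × Fin M) X := by
    rw [hX, AddEquiv.apply_symm_apply]
  have hX1 : ∀ p, (X p).1 = 0 := by
    intro p
    rw [hX, UnitaryGroup.QuadraticCoordinates.reIm_symm_apply]
    change (UnitaryGroup.quadraticAdeleEquiv F E c hcδ hδ (w.1 p, w.2 p)).1 = 0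
    rw [UnitaryGroup.quadraticAdeleEquiv_apply]
    have h1 : (w.1 p).1 = 0 := by rw [hw, UnitaryGroup.reindexW_symm_apply]; exact hv1 _
    have h2 : (w.2 p).1 = 0 := by rw [hw, UnitaryGroup.reindexW_symm_apply]; exact hv2 _
    change (AdeleRing.baseChange F E (w.1 p)).1 + (AdeleRing.baseChange F E (w.2 p)).1 *
      (algebraMap E (AdeleRing (𝓞 E) E) δ).1 = 0
    rw [AdeleRing.baseChange_fst, AdeleRing.baseChange_fst, h1, h2, map_zero, zero_mul, add_zero]
  have hact : ((UnitaryGroup.adelicPairToSymplectic F E c N M hcδ hδ hd hV hW hJV hJW g :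
      symplecticGroup _) : _ ≃ₗ[AdeleRing (𝓞 F) F] _) w = h.resAut (Fin N × Fin M) (g : GL (Fin N × Fin M) _) w := rfl
  rw [hact, hwX, h.resAut_reIm, mulVec_eq_self_of_snd_eq_one _ (pair_archToAdelic_apply_snd F E c N M JV JW x y) X hX1,
    ← hwX, hw, LinearEquiv.apply_symm_apply]

/-- membership in `finHeisenberg`: the archimedean components of the vector part vanish. -/
theorem fst_apply_fst_eq_zero_of_mem_finHeisenberg {ι : Type} [Fintype ι] [DecidableEq ι]
    {T : Matrix ι ι (AdeleRing (𝓞 F) F)} {h : AdelicHeisenberg F ι T} (hh : h ∈ finHeisenberg T) (i : ι) :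
    (h.v.1 i).1 = 0 ∧ (h.v.2 i).1 = 0 := by
  rw [mem_finHeisenberg_iff] at hh
  have h1 := congrArg (fun v => (v.1 i).1) hh
  have h2 := congrArg (fun v => (v.2 i).1) hh
  simp only [Prod.smul_fst, Prod.smul_snd, Pi.smul_apply, smul_eq_mul, finIdem_mul] at h1 h2
  exact ⟨h1.symm, h2.symm⟩

set_option maxHeartbeats 4000000 in
/-- **Tensor stripping over a vector-fixing element**: if `s g ∈ Mp_ψ(𝕎_𝔸)ᶜᵒⁿᵗ` lies over `toSp g` and `toSp g`
fixes every finitely supported vector, then `ω_ψ(s g) = A ⊗ 1` for a topological automorphism `A` of the archimedean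
Schwartz space. -/
theorem exists_archFactor_of_fix [Algebra.IsQuadraticExtension F E] {δ : E} (hcδ : c δ = -δ) (hδ : δ ≠ 0)
    {d : F} (hd : δ * δ = algebraMap F E d) {TV : Matrix (Fin N) (Fin N) F} {TW : Matrix (Fin M) (Fin M) F}
    (hV : TV.IsSymm) (hW : TW.IsSymm) (hVd : IsUnit TV.det) (hWd : IsUnit TW.det)
    (hJV : JV = TV.map (algebraMap F E)) (hJW : JW = TW.map (algebraMap F E))
    {n : ℕ} (e : Fin N × Fin M ≃ Fin n)
    (s : UnitaryGroup.adelicPair F E c N M JV JW →* adelicMpCont F (Fin n) (UnitaryDualPair.adelicGram F e TV TW))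
    (g : UnitaryGroup.adelicPair F E c N M JV JW)
    (hproj : adelicMpCont.proj F (Fin n) (UnitaryDualPair.adelicGram F e TV TW) (s g) = UnitaryDualPair.toSp F E c N M e JV JW hcδ hδ hd hV hW hJV hJW g)
    (hfix : ∀ v : (Fin n → AdeleRing (𝓞 F) F) × (Fin n → AdeleRing (𝓞 F) F),
      (∀ i, (v.1 i).1 = 0) → (∀ i, (v.2 i).1 = 0) →
        ((UnitaryDualPair.toSp F E c N M e JV JW hcδ hδ hd hV hW hJV hJW g :
            symplecticGroup (polar (adelicForm F (Fin n) (UnitaryDualPair.adelicGram F e TV TW)))) :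
          ((Fin n → AdeleRing (𝓞 F) F) × (Fin n → AdeleRing (𝓞 F) F)) ≃ₗ[AdeleRing (𝓞 F) F]
            ((Fin n → AdeleRing (𝓞 F) F) × (Fin n → AdeleRing (𝓞 F) F))) v = v) :
    ∃ A : SchwartzMap (Fin n → mixedEmbedding.mixedSpace F) ℂ ≃L[ℂ] SchwartzMap (Fin n → mixedEmbedding.mixedSpace F) ℂ,
      ∀ (Φinf : SchwartzMap (Fin n → mixedEmbedding.mixedSpace F) ℂ) (f : FinSB F (Fin n)),
        adelicMpCont.omega F (Fin n) (UnitaryDualPair.adelicGram F e TV TW) (s g) (piSchwartzBruhatEquiv F (Fin n) (Φinf ⊗ₜ[ℂ] f)) =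
          piSchwartzBruhatEquiv F (Fin n) (A Φinf ⊗ₜ[ℂ] f) := by
  have hT : Function.Surjective fun v : Fin n → AdeleRing (𝓞 F) F => UnitaryDualPair.adelicGram F e TV TW *ᵥ v :=
    Matrix.mulVec_surjective_iff_isUnit.2
      ((Matrix.isUnit_iff_isUnit_det _).2 (UnitaryDualPair.isUnit_det_adelicGram F e hVd hWd))
  have hsp : ((s g).1 : ↥(adelicMp F (Fin n) (UnitaryDualPair.adelicGram F e TV TW))).1.1 =
      UnitaryDualPair.toSp F E c N M e JV JW hcδ hδ hd hV hW hJV hJW g := by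
    have h := hproj
    rw [adelicMpCont.proj_apply, Literature.RepresentationTheory.HeisenbergGroup.MpPsi.proj_apply] at h
    exact h
  have hact : ∀ h ∈ finHeisenberg (UnitaryDualPair.adelicGram F e TV TW),
      (ofSymplectic (polar (adelicForm F (Fin n) (UnitaryDualPair.adelicGram F e TV TW)))
        ((s g).1 : ↥(adelicMp F (Fin n) (UnitaryDualPair.adelicGram F e TV TW))).1.1).act h = h := by
    intro h hh
    have hv : ((((s g).1 : ↥(adelicMp F (Fin n) (UnitaryDualPair.adelicGram F e TV TW))).1.1 :
        _ ≃ₗ[AdeleRing (𝓞 F) F] _) : _ → _) h.v = h.v := by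
      rw [hsp]
      exact hfix h.v (fun i => (fst_apply_fst_eq_zero_of_mem_finHeisenberg F hh i).1)
        (fun i => (fst_apply_fst_eq_zero_of_mem_finHeisenberg F hh i).2)
    apply Heisenberg.ext
    · rw [Heisenberg.PseudoSymplectic.act_v, ofSymplectic_σ]
      exact hv
    · rw [Heisenberg.PseudoSymplectic.act_t, ofSymplectic_f, hv, sub_self, mul_zero, add_zero]
  have hMf : ∀ h ∈ finHeisenberg (UnitaryDualPair.adelicGram F e TV TW), ∀ Φ : ↥(piSchwartzBruhat F (Fin n)),
      adelicTensorEnd LinearMap.id ((LinearEquiv.refl ℂ (FinSB F (Fin n)) : FinSB F (Fin n) →ₗ[ℂ] FinSB F (Fin n)))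
          (adelicSchrodinger F (Fin n) (UnitaryDualPair.adelicGram F e TV TW) h Φ) =
        adelicSchrodinger F (Fin n) (UnitaryDualPair.adelicGram F e TV TW)
          ((ofSymplectic (polar (adelicForm F (Fin n) (UnitaryDualPair.adelicGram F e TV TW)))
            ((s g).1 : ↥(adelicMp F (Fin n) (UnitaryDualPair.adelicGram F e TV TW))).1.1).act h)
          (adelicTensorEnd LinearMap.id
            ((LinearEquiv.refl ℂ (FinSB F (Fin n)) : FinSB F (Fin n) →ₗ[ℂ] FinSB F (Fin n))) Φ) := by
    intro h hh Φ
    rw [hact h hh, LinearEquiv.refl_toLinearMap, adelicTensorEnd_id, LinearMap.id_apply, LinearMap.id_apply]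
  obtain ⟨A, hA⟩ := exists_continuousLinearEquiv_map_tmul_of_mem_adelicMpCont (F := F) (ι := Fin n)
    (T := UnitaryDualPair.adelicGram F e TV TW) hT (s g).1 (s g).2 (LinearEquiv.refl ℂ (FinSB F (Fin n))) hMf
  refine ⟨A, fun Φinf f => ?_⟩
  rw [adelicMpCont.omega_apply, omegaPsi_apply]
  exact (hA Φinf f).1

/-- **Tensor stripping at an ARCHIMEDEAN pair element** `(x ⊗ 1)(1 ⊗ y)`, `x, y` archimedean. -/
theorem exists_archFactor [Algebra.IsQuadraticExtension F E] {δ : E} (hcδ : c δ = -δ) (hδ : δ ≠ 0)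
    {d : F} (hd : δ * δ = algebraMap F E d) {TV : Matrix (Fin N) (Fin N) F} {TW : Matrix (Fin M) (Fin M) F}
    (hV : TV.IsSymm) (hW : TW.IsSymm) (hVd : IsUnit TV.det) (hWd : IsUnit TW.det)
    (hJV : JV = TV.map (algebraMap F E)) (hJW : JW = TW.map (algebraMap F E))
    {n : ℕ} (e : Fin N × Fin M ≃ Fin n)
    (s : UnitaryGroup.adelicPair F E c N M JV JW →* adelicMpCont F (Fin n) (UnitaryDualPair.adelicGram F e TV TW))
    (hs : ∀ g, adelicMpCont.proj F (Fin n) (UnitaryDualPair.adelicGram F e TV TW) (s g) = UnitaryDualPair.toSp F E c N M e JV JW hcδ hδ hd hV hW hJV hJW g)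
    (x : UnitaryGroup.arch F E c N JV) (y : UnitaryGroup.arch F E c M JW) :
    ∃ A : SchwartzMap (Fin n → mixedEmbedding.mixedSpace F) ℂ ≃L[ℂ] SchwartzMap (Fin n → mixedEmbedding.mixedSpace F) ℂ,
      ∀ (Φinf : SchwartzMap (Fin n → mixedEmbedding.mixedSpace F) ℂ) (f : FinSB F (Fin n)),
        adelicMpCont.omega F (Fin n) (UnitaryDualPair.adelicGram F e TV TW)
            (s (UnitaryGroup.adelicInl F E c N M JV JW (UnitaryGroup.archToAdelic F E c N JV x) *
              UnitaryGroup.adelicInr F E c N M JV JW (UnitaryGroup.archToAdelic F E c M JW y)))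
            (piSchwartzBruhatEquiv F (Fin n) (Φinf ⊗ₜ[ℂ] f)) =
          piSchwartzBruhatEquiv F (Fin n) (A Φinf ⊗ₜ[ℂ] f) :=
  exists_archFactor_of_fix F E c N M JV JW hcδ hδ hd hV hW hVd hWd hJV hJW e s _ (hs _)
    (toSp_arch_apply_eq_self F E c N M JV JW hcδ hδ hd hV hW hJV hJW e x y)

/-! ## §2 The archimedean Weil representation of the pinned splitting (theta-2's `archRepMp` at the pair) -/

/-- **The archimedean pair group inside `G₁(𝔸_F)`**: `(x, y) ↦ (x_∞,1) ⊗ (y_∞,1)` (tree `dualPair ∘ (archToAdelic × archToAdelic)`). -/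
def archPairHom : UnitaryGroup.arch F E c N JV × UnitaryGroup.arch F E c M JW →* UnitaryGroup.adelicPair F E c N M JV JW :=
  (UnitaryGroup.dualPair (UnitaryGroup.conjAdele F E c) (UnitaryGroup.adelicForm E N JV) (UnitaryGroup.adelicForm E M JW)).comp
    ((UnitaryGroup.archToAdelic F E c N JV).prodMap (UnitaryGroup.archToAdelic F E c M JW))

/-- `archPairHom (x, y) = (x⊗1)·(1⊗y)` with `x, y` pushed to the adelic groups. -/
theorem archPairHom_apply (x : UnitaryGroup.arch F E c N JV) (y : UnitaryGroup.arch F E c M JW) :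
    archPairHom F E c N M JV JW (x, y) =
      UnitaryGroup.adelicInl F E c N M JV JW (UnitaryGroup.archToAdelic F E c N JV x) *
        UnitaryGroup.adelicInr F E c N M JV JW (UnitaryGroup.archToAdelic F E c M JW y) := by
  apply Subtype.ext
  apply Units.ext
  rw [Subgroup.coe_mul, Units.val_mul, UnitaryGroup.coe_adelicInl, UnitaryGroup.coe_adelicInr,
    ← Matrix.mul_kronecker_mul, Matrix.mul_one, Matrix.one_mul]
  rfl

/-- If `toSp g` fixes the finitely supported vectors and `s g` lies over `toSp g`, the Weil section of `proj (s g)`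
fixes the finite Heisenberg elements (theta-2's hypothesis `hfin` of `archRepMp`). -/
theorem act_eq_self_of_fix [Algebra.IsQuadraticExtension F E] {δ : E} (hcδ : c δ = -δ) (hδ : δ ≠ 0)
    {d : F} (hd : δ * δ = algebraMap F E d) {TV : Matrix (Fin N) (Fin N) F} {TW : Matrix (Fin M) (Fin M) F}
    (hV : TV.IsSymm) (hW : TW.IsSymm) (hJV : JV = TV.map (algebraMap F E)) (hJW : JW = TW.map (algebraMap F E))
    {n : ℕ} (e : Fin N × Fin M ≃ Fin n)
    (s : UnitaryGroup.adelicPair F E c N M JV JW →* adelicMpCont F (Fin n) (UnitaryDualPair.adelicGram F e TV TW))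
    (g : UnitaryGroup.adelicPair F E c N M JV JW)
    (hproj : adelicMpCont.proj F (Fin n) (UnitaryDualPair.adelicGram F e TV TW) (s g) =
      UnitaryDualPair.toSp F E c N M e JV JW hcδ hδ hd hV hW hJV hJW g)
    (hfix : ∀ v : (Fin n → AdeleRing (𝓞 F) F) × (Fin n → AdeleRing (𝓞 F) F),
      (∀ i, (v.1 i).1 = 0) → (∀ i, (v.2 i).1 = 0) →
        ((UnitaryDualPair.toSp F E c N M e JV JW hcδ hδ hd hV hW hJV hJW g :
            symplecticGroup (polar (adelicForm F (Fin n) (UnitaryDualPair.adelicGram F e TV TW)))) :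
          ((Fin n → AdeleRing (𝓞 F) F) × (Fin n → AdeleRing (𝓞 F) F)) ≃ₗ[AdeleRing (𝓞 F) F]
            ((Fin n → AdeleRing (𝓞 F) F) × (Fin n → AdeleRing (𝓞 F) F))) v = v)
    (w : AdelicHeisenberg F (Fin n) (UnitaryDualPair.adelicGram F e TV TW))
    (hw : w ∈ finHeisenberg (UnitaryDualPair.adelicGram F e TV TW)) :
    (ofSymplectic (polar (adelicForm F (Fin n) (UnitaryDualPair.adelicGram F e TV TW)))
      (adelicMpCont.proj F (Fin n) (UnitaryDualPair.adelicGram F e TV TW) (s g))).act w = w := by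
  have hv : (((UnitaryDualPair.toSp F E c N M e JV JW hcδ hδ hd hV hW hJV hJW g :
        symplecticGroup (polar (adelicForm F (Fin n) (UnitaryDualPair.adelicGram F e TV TW)))) :
      _ ≃ₗ[AdeleRing (𝓞 F) F] _) : _ → _) w.v = w.v :=
    hfix w.v (fun i => (fst_apply_fst_eq_zero_of_mem_finHeisenberg F hw i).1)
      (fun i => (fst_apply_fst_eq_zero_of_mem_finHeisenberg F hw i).2)
  rw [hproj]
  apply Heisenberg.ext
  · rw [Heisenberg.PseudoSymplectic.act_v, ofSymplectic_σ]
    exact hv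
  · rw [Heisenberg.PseudoSymplectic.act_t, ofSymplectic_f, hv, sub_self, mul_zero, add_zero]

set_option maxHeartbeats 4000000 in
/-- **theta-2's hypothesis `hfin` HOLDS on the archimedean pair group**: for every `(x, y)` archimedean the Weil
section of `proj (s (archPairHom (x,y)))` fixes the finite Heisenberg elements. -/
theorem hfin_archPairHom [Algebra.IsQuadraticExtension F E] {δ : E} (hcδ : c δ = -δ) (hδ : δ ≠ 0)
    {d : F} (hd : δ * δ = algebraMap F E d) {TV : Matrix (Fin N) (Fin N) F} {TW : Matrix (Fin M) (Fin M) F}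
    (hV : TV.IsSymm) (hW : TW.IsSymm) (hJV : JV = TV.map (algebraMap F E)) (hJW : JW = TW.map (algebraMap F E))
    {n : ℕ} (e : Fin N × Fin M ≃ Fin n)
    (s : UnitaryGroup.adelicPair F E c N M JV JW →* adelicMpCont F (Fin n) (UnitaryDualPair.adelicGram F e TV TW))
    (hs : ∀ g, adelicMpCont.proj F (Fin n) (UnitaryDualPair.adelicGram F e TV TW) (s g) =
      UnitaryDualPair.toSp F E c N M e JV JW hcδ hδ hd hV hW hJV hJW g) :
    ∀ u : UnitaryGroup.arch F E c N JV × UnitaryGroup.arch F E c M JW,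
      ∀ w ∈ finHeisenberg (UnitaryDualPair.adelicGram F e TV TW),
        (ofSymplectic (polar (adelicForm F (Fin n) (UnitaryDualPair.adelicGram F e TV TW)))
          (adelicMpCont.proj F (Fin n) (UnitaryDualPair.adelicGram F e TV TW)
            ((s.comp (archPairHom F E c N M JV JW)) u))).act w = w := by
  rintro ⟨x, y⟩ w hw
  rw [MonoidHom.comp_apply, archPairHom_apply]
  exact act_eq_self_of_fix F E c N M JV JW hcδ hδ hd hV hW hJV hJW e s _ (hs _)
    (toSp_arch_apply_eq_self F E c N M JV JW hcδ hδ hd hV hW hJV hJW e x y) w hw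

/-- **The archimedean pair group pushed into the adelic product group**: `(x, y) ↦ ((x_∞,1), (y_∞,1))`. -/
def archProdHom : UnitaryGroup.arch F E c N JV × UnitaryGroup.arch F E c M JW →*
    ↥(UnitaryGroup.adelic F E c N JV) × ↥(UnitaryGroup.adelic F E c M JW) :=
  (UnitaryGroup.archToAdelic F E c N JV).prodMap (UnitaryGroup.archToAdelic F E c M JW)

set_option maxHeartbeats 4000000 in
/-- **theta-2's hypothesis `hfin` HOLDS for the pair splitting on the archimedean pair group**: for every `(x, y)`
archimedean the Weil section of `proj (s_pair (x_∞, y_∞))` fixes the finite Heisenberg elements. -/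
theorem hfin_pairSplitting_arch [Algebra.IsQuadraticExtension F E] {δ : E} (hcδ : c δ = -δ) (hδ : δ ≠ 0)
    {d : F} (hd : δ * δ = algebraMap F E d) {TV : Matrix (Fin N) (Fin N) F} {TW : Matrix (Fin M) (Fin M) F}
    (hV : TV.IsSymm) (hW : TW.IsSymm) (hJV : JV = TV.map (algebraMap F E)) (hJW : JW = TW.map (algebraMap F E))
    {n : ℕ} (e : Fin N × Fin M ≃ Fin n)
    (s : UnitaryGroup.adelicPair F E c N M JV JW →* adelicMpCont F (Fin n) (UnitaryDualPair.adelicGram F e TV TW))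
    (hs : ∀ g, adelicMpCont.proj F (Fin n) (UnitaryDualPair.adelicGram F e TV TW) (s g) =
      UnitaryDualPair.toSp F E c N M e JV JW hcδ hδ hd hV hW hJV hJW g) :
    ∀ u : UnitaryGroup.arch F E c N JV × UnitaryGroup.arch F E c M JW,
      ∀ w ∈ finHeisenberg (UnitaryDualPair.adelicGram F e TV TW),
        (ofSymplectic (polar (adelicForm F (Fin n) (UnitaryDualPair.adelicGram F e TV TW)))
          (adelicMpCont.proj F (Fin n) (UnitaryDualPair.adelicGram F e TV TW)
            (((UnitaryDualPair.pairSplitting F E c N M e JV JW s).comp (archProdHom F E c N M JV JW)) u))).act w = w := by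
  rintro ⟨x, y⟩ w hw
  exact act_eq_self_of_fix F E c N M JV JW hcδ hδ hd hV hW hJV hJW e s _ (hs _)
    (toSp_arch_apply_eq_self F E c N M JV JW hcδ hδ hd hV hW hJV hJW e x y) w hw

/-- **The archimedean Weil representation of a pinned splitting** `s` (lying over `toSp`): theta-2's read-off
`archRepMp` of the finite-trivial homomorphism `s_pair ∘ (archToAdelic × archToAdelic)` — a REPRESENTATION of `U(J_V)(E⊗ℝ) × U(J_W)(E⊗ℝ)`
on `𝓢((F ⊗ ℝ)^n)` with `ω_ψ(s(x_∞ ⊗ y_∞)) = archWeilRep (x,y) ⊗ 1`. [Weil1964, Chap. III n° 37–38: `𝐫_𝐀 = ⊗_v 𝐫_v`] -/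
def archWeilRep [Algebra.IsQuadraticExtension F E] {δ : E} (hcδ : c δ = -δ) (hδ : δ ≠ 0)
    {d : F} (hd : δ * δ = algebraMap F E d) {TV : Matrix (Fin N) (Fin N) F} {TW : Matrix (Fin M) (Fin M) F}
    (hV : TV.IsSymm) (hW : TW.IsSymm) (hVd : IsUnit TV.det) (hWd : IsUnit TW.det)
    (hJV : JV = TV.map (algebraMap F E)) (hJW : JW = TW.map (algebraMap F E))
    {n : ℕ} (e : Fin N × Fin M ≃ Fin n)
    (s : UnitaryGroup.adelicPair F E c N M JV JW →* adelicMpCont F (Fin n) (UnitaryDualPair.adelicGram F e TV TW))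
    (hs : ∀ g, adelicMpCont.proj F (Fin n) (UnitaryDualPair.adelicGram F e TV TW) (s g) =
      UnitaryDualPair.toSp F E c N M e JV JW hcδ hδ hd hV hW hJV hJW g) :
    Representation ℂ (UnitaryGroup.arch F E c N JV × UnitaryGroup.arch F E c M JW)
      (SchwartzMap (Fin n → mixedEmbedding.mixedSpace F) ℂ) :=
  archRepMp (Matrix.mulVec_surjective_iff_isUnit.2
      ((Matrix.isUnit_iff_isUnit_det _).2 (UnitaryDualPair.isUnit_det_adelicGram F e hVd hWd)))
    ((UnitaryDualPair.pairSplitting F E c N M e JV JW s).comp (archProdHom F E c N M JV JW))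
    (hfin_pairSplitting_arch F E c N M JV JW hcδ hδ hd hV hW hJV hJW e s hs)

/-- **`ω_ψ(s_pair(x_∞, y_∞)) (Φ_∞ ⊗ Φ_f) = (archWeilRep (x,y) Φ_∞) ⊗ Φ_f`.** -/
theorem omega_pairSplitting_arch_map_tmul [Algebra.IsQuadraticExtension F E] {δ : E} (hcδ : c δ = -δ) (hδ : δ ≠ 0)
    {d : F} (hd : δ * δ = algebraMap F E d) {TV : Matrix (Fin N) (Fin N) F} {TW : Matrix (Fin M) (Fin M) F}
    (hV : TV.IsSymm) (hW : TW.IsSymm) (hVd : IsUnit TV.det) (hWd : IsUnit TW.det)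
    (hJV : JV = TV.map (algebraMap F E)) (hJW : JW = TW.map (algebraMap F E))
    {n : ℕ} (e : Fin N × Fin M ≃ Fin n)
    (s : UnitaryGroup.adelicPair F E c N M JV JW →* adelicMpCont F (Fin n) (UnitaryDualPair.adelicGram F e TV TW))
    (hs : ∀ g, adelicMpCont.proj F (Fin n) (UnitaryDualPair.adelicGram F e TV TW) (s g) =
      UnitaryDualPair.toSp F E c N M e JV JW hcδ hδ hd hV hW hJV hJW g)
    (u : UnitaryGroup.arch F E c N JV × UnitaryGroup.arch F E c M JW)
    (Φinf : SchwartzMap (Fin n → mixedEmbedding.mixedSpace F) ℂ) (f : FinSB F (Fin n)) :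
    adelicMpCont.omega F (Fin n) (UnitaryDualPair.adelicGram F e TV TW)
        (UnitaryDualPair.pairSplitting F E c N M e JV JW s (archProdHom F E c N M JV JW u))
        (piSchwartzBruhatEquiv F (Fin n) (Φinf ⊗ₜ[ℂ] f)) =
      piSchwartzBruhatEquiv F (Fin n) (archWeilRep F E c N M JV JW hcδ hδ hd hV hW hVd hWd hJV hJW e s hs u Φinf ⊗ₜ[ℂ] f) :=
  omega_map_tmul _ ((UnitaryDualPair.pairSplitting F E c N M e JV JW s).comp (archProdHom F E c N M JV JW)) _ u Φinf f


-- port_pkg: scope closed for this part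
end Pair
end HodgeCM.Model.HypCensus
end
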